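import Mathlib
import Summits.NavierStokesRegularity.NavierStokesRegularity.Theorems.TypeIQuarterGateScarEnvelopeTypeISatelliteTowerRigidRoot

/-!
# Satellite tower for crux `ScarEnvelopeTypeI` (stmt-NavierStokesRegularity-23843) — Part U5–U7: WILD doubly-minimal roots; the rigid ROOT census of ¬23843; 23843 from two rigid root exclusions

Part U5–U7 of nsreg-p3's ROUND-40 artefact (section `RigidRoot`): U5 `DoublyMin.wild_sphere` (wild roots carry satellites at every radius);
U6 ★ `tameLeaf_or_rigidRootDescent_of_not_scarEnvelopeTypeI`, ★ `tame_or_wild_of_not_scarEnvelopeTypeI` (¬23843 ⇒ a TAME, KNSS-enveloped, one-scar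
doubly-minimal leaf ∨ WILD: no tame member, a rigid root descent, and a wild leaf or a rigid satellite descent); U7 `scarEnvelopeTypeI_of_rigidRoot_exclusions`,
`scarEnvelopeTypeI_of_noEnvelopedLeaf_noRigidRootDescent`, `rigidRoot_exclusions_of_root_exclusions`.

PROVENANCE: declaration texts VERBATIM from the HOME artefact of the instrument seat nsreg-p3 g27 (cell `pub/ns-regularity-ideate`):
`round-40/Root40.lean` (sha16 `d3d4255074edfeef`, NEW part `partU.lean`; a standalone module written against the TREE;
memo `round-40/ROUND-40.md` c4a2dbdad86380a6), scored PASS ★★ by referee ref3 g27 (`SCORE-p3-ROUND-40-0828.md` 41a324c979557729); the author cannot write under `Theorems/`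
(`perm.theorems-prover-only`); landed by the prover ns-es-p1 g5 as landing hand of record (director-ns DIRECTOR-NS #237 (3)), split into
≤ 400-line modules, `E3` spelled out, the artefact's `#guard_msgs … #print axioms` certificates not landed.
`--supports stmt-NavierStokesRegularity-23843 --as helper`.

HONEST FRAMING: instrument theorems about HYPOTHETICAL Type-I zoom limits (Albritton–Barker objects of the census of crux
`TypeIQuarterGate.ScarEnvelopeTypeI`, item 23843); the analytic input is the tree's closure engine (compactness
`local_typeI_compactness_twin_inBall`, sharpened to constant 1 in Part S1; Q1 whole-space), P1 rate inheritance, L8 persistence and the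
tree's PROVED small-constant Liouville theorem; Parts R/S are order theory on the re-classing and closure lemmas.  NOTHING OPEN IS
PROVED: 23843, (L′) `TypeILiouvilleAB` / (L′₀), the GLOBAL (S∞) = `CritAttained`, (M𝐈₁), (E1⁺), (E2ᵣ), route ExtremalTypeIConstant's
cruxes, N0 and Navier–Stokes regularity are OPEN; `critRate`, `levelCrit I`, `liouvilleRate` are `sInf`s that are `0` by junk value
when the defining set is empty (every statement using them carries the nonemptiness hypothesis explicitly).
-/

-- the summit-side namespace repeats a component by design (single-conjunct summit, D-0017)
set_option linter.dupNamespace false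

open MeasureTheory Set Metric Filter Topology
open scoped ENNReal NNReal InnerProductSpace
open Literature.Analysis.FluidPDE

namespace Summit.NavierStokesRegularity.NavierStokesRegularity.Cruxes.ScarEnvelopeTypeI.ZoomDictionary

section RigidRoot

variable {U : ℝ → (EuclideanSpace ℝ (Fin 3)) → (EuclideanSpace ℝ (Fin 3))} {P : ℝ → (EuclideanSpace ℝ (Fin 3)) → ℝ}

/-! #### U5. WILD doubly-minimal roots: satellites at every radius -/

/-- ★ **U5. THE WILD ALTERNATIVE IS SCALE-FILLING.**  If NO doubly-minimal object of the level is tame at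
its root, then for EVERY doubly-minimal object and EVERY radius `r ∈ (0,1)` some root blow-up of it is a
doubly-minimal object of the same level with a satellite EXACTLY at radius `r` (root meter at `κ = r⁻¹`),
rated exactly `M_c(I)`. -/
theorem DoublyMin.wild_sphere {I : ℝ≥0∞} (hW : ∀ n : TNode, DoublyMin I n → ¬ TameRoot n)
    {n : TNode} (h : DoublyMin I n) {r : ℝ} (hr : r ∈ Ioo (0 : ℝ) 1) :
    ∃ n' : TNode, DoublyMin I n' ∧ n'.level = n.level ∧ RootBlowup n n' ∧
      ‖n'.y‖ = r ∧ n'.y ∈ satellites n'.U ∧ tightRate n'.U n'.y = levelCrit I := by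
  have hκ : 1 < r⁻¹ := one_lt_inv_iff₀.2 ⟨hr.1, hr.2⟩
  rcases h.tame_or_sphere hκ with hb | ⟨n', hD', hlev, hrb, hz, hsat⟩
  · exact absurd hb (hW n h)
  · rw [inv_inv] at hz
    exact ⟨n', hD', hlev, hrb, hz, hsat, hD'.1.tightRate_eq hsat.2⟩

/-! #### U6. THE RIGID ROOT CENSUS OF ¬23843, and the TAME / WILD census -/

/-- ★★★ **U6. THE RIGID ROOT CENSUS.**  If 23843 fails, then at the finite energy level `I₀` of the
violating object (class `M_c(I₀) ∈ [ε_L, M]`) there is EITHER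
(A) a TAME doubly-minimal ONE-SCAR LEAF, KNSS-ENVELOPED on the unit window about its root (exactly
`M_c(I₀)`-rated isolated root scar, minimal energy; by U4 all its root blow-ups are again such), OR
(B) a RIGID ROOT DESCENT (an infinite root descent of doubly-minimal NON-tame objects: flat exact root rates
`M_c(I₀)`, constant energy `minLevel I₀`, a sphere satellite of exact rate `M_c(I₀)` at every level). -/
theorem tameLeaf_or_rigidRootDescent_of_not_scarEnvelopeTypeI
    (h : ¬ Summit.NavierStokesRegularity.NavierStokesRegularity.Theses.TypeIQuarterGate.ScarEnvelopeTypeI) :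
    ∃ (M : ℝ) (I₀ : ℝ≥0∞), I₀ < ⊤ ∧ (levelRates I₀).Nonempty ∧ levelCrit I₀ ∈ Icc epsL M ∧
      minLevel I₀ ≤ I₀ ∧
      ((∃ (n : TNode) (A : ℝ), DoublyMin I₀ n ∧ TameRoot n ∧ LeafNode n ∧ EnvNode A n) ∨
        RigidRootDescent I₀) := by
  obtain ⟨M, I₀, hI₀, hne, hIcc, -, -⟩ := exactCritical_of_not_scarEnvelopeTypeI h
  refine ⟨M, I₀, hI₀, hne, hIcc, minLevel_le_self hI₀ hne, ?_⟩
  rcases doublyMin_tame_or_rigidRootDescent hI₀ hne with ⟨n, hn, hb⟩ | hd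
  · obtain ⟨n', hD', -, -, hleaf, ⟨A, hA⟩, hb'⟩ := hn.exists_tameLeaf hb
    exact Or.inl ⟨n', A, hD', hb', hleaf, hA⟩
  · exact Or.inr hd

/-- ★★★ **U6b. THE TAME / WILD CENSUS** (U6 joined with T6).  If 23843 fails, then at the level `I₀`:
EITHER (TAME) a tame, enveloped, one-scar doubly-minimal leaf exists; OR (WILD) EVERY doubly-minimal object
of the level is non-tame at its root — so each has root blow-ups with satellites at every radius (U5) —,
there is a rigid ROOT descent, AND (Part T) there is a WILD one-scar doubly-minimal leaf (root scar isolated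
in the unit ball but NOT enveloped) or a rigid SATELLITE descent. -/
theorem tame_or_wild_of_not_scarEnvelopeTypeI
    (h : ¬ Summit.NavierStokesRegularity.NavierStokesRegularity.Theses.TypeIQuarterGate.ScarEnvelopeTypeI) :
    ∃ (M : ℝ) (I₀ : ℝ≥0∞), I₀ < ⊤ ∧ (levelRates I₀).Nonempty ∧ levelCrit I₀ ∈ Icc epsL M ∧
      minLevel I₀ ≤ I₀ ∧
      ((∃ (n : TNode) (A : ℝ), DoublyMin I₀ n ∧ TameRoot n ∧ LeafNode n ∧ EnvNode A n) ∨
        ((∀ n : TNode, DoublyMin I₀ n → ¬ TameRoot n) ∧ RigidRootDescent I₀ ∧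
          ((∃ n : TNode, DoublyMin I₀ n ∧ LeafNode n ∧ ¬ TameRoot n) ∨ RigidDescent I₀))) := by
  obtain ⟨M, I₀, hI₀, hne, hIcc, -, -⟩ := exactCritical_of_not_scarEnvelopeTypeI h
  refine ⟨M, I₀, hI₀, hne, hIcc, minLevel_le_self hI₀ hne, ?_⟩
  by_cases hA : ∃ n : TNode, DoublyMin I₀ n ∧ TameRoot n
  · obtain ⟨n, hn, hb⟩ := hA
    obtain ⟨n', hD', -, -, hleaf, ⟨A, hA'⟩, hb'⟩ := hn.exists_tameLeaf hb
    exact Or.inl ⟨n', A, hD', hb', hleaf, hA'⟩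
  · have hW : ∀ n : TNode, DoublyMin I₀ n → ¬ TameRoot n := fun n hn hb => hA ⟨n, hn, hb⟩
    refine Or.inr ⟨hW, ?_, ?_⟩
    · rcases doublyMin_tame_or_rigidRootDescent hI₀ hne with ⟨n, hn, hb⟩ | hd
      · exact absurd hb (hW n hn)
      · exact hd
    · rcases doublyMin_leaf_or_rigidDescent hI₀ hne with ⟨n, hn, hl⟩ | hd
      · exact Or.inl ⟨n, hn, hl, hW n hn⟩
      · exact Or.inr hd

/-- ★★ **U7. 23843 FROM THE TWO RIGID ROOT EXCLUSIONS**: no finite level has a tame doubly-minimal object,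
and no finite level has a rigid root descent. -/
theorem scarEnvelopeTypeI_of_rigidRoot_exclusions
    (hA : ∀ I : ℝ≥0∞, I < ⊤ → ∀ n : TNode, DoublyMin I n → ¬ TameRoot n)
    (hB : ∀ I : ℝ≥0∞, I < ⊤ → ¬ RigidRootDescent I) :
    Summit.NavierStokesRegularity.NavierStokesRegularity.Theses.TypeIQuarterGate.ScarEnvelopeTypeI := by
  by_contra h
  obtain ⟨M, I₀, hI₀, -, -, -, hcases⟩ := tameLeaf_or_rigidRootDescent_of_not_scarEnvelopeTypeI h
  rcases hcases with ⟨n, A, hn, hb, -, -⟩ | hd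
  · exact hA I₀ hI₀ n hn hb
  · exact hB I₀ hI₀ hd

/-- U7b. In the tree's currency: excluding ENVELOPED LEAVES of the classes `≥ ε_L` ((E1⁺), via
`envelopedLeaf_of_tameRoot`) and rigid root descents of all finite levels gives 23843 — the hypotheses of
the tree's `scarEnvelopeTypeI_of_noEnvelopedLeaf_noDescent` restricted to exactly-critical, energy-minimal,
self-reproducing objects. -/
theorem scarEnvelopeTypeI_of_noEnvelopedLeaf_noRigidRootDescent
    (hE : ∀ M A : ℝ, epsL ≤ M → ¬ EnvelopedLeaf M A)
    (hB : ∀ I : ℝ≥0∞, I < ⊤ → ¬ RigidRootDescent I) :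
    Summit.NavierStokesRegularity.NavierStokesRegularity.Theses.TypeIQuarterGate.ScarEnvelopeTypeI := by
  by_contra h
  obtain ⟨M, I₀, hI₀, -, hIcc, -, hcases⟩ := tameLeaf_or_rigidRootDescent_of_not_scarEnvelopeTypeI h
  rcases hcases with ⟨n, A, hn, hb, -, -⟩ | hd
  · obtain ⟨A', hA'⟩ := envelopedLeaf_of_tameRoot hn.1.1.1 hn.1.1.2 hb
    exact hE _ A' hIcc.1 hA'
  · exact hB I₀ hI₀ hd

/-- U7c. The rigid root exclusions are WEAKER hypotheses than the tree's root exclusions. -/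
theorem rigidRoot_exclusions_of_root_exclusions
    (hE : ∀ M A : ℝ, ¬ EnvelopedLeaf M A) (hI : ∀ M : ℝ, ¬ InfiniteRootDescent M) :
    (∀ I : ℝ≥0∞, I < ⊤ → ∀ n : TNode, DoublyMin I n → ¬ TameRoot n) ∧
      (∀ I : ℝ≥0∞, I < ⊤ → ¬ RigidRootDescent I) :=
  ⟨fun I _ n hn hb => by
    obtain ⟨A, hA⟩ := envelopedLeaf_of_tameRoot hn.1.1.1 hn.1.1.2 hb
    exact hE _ A hA,
  fun I _ hd => hI _ hd.infiniteRootDescent⟩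

end RigidRoot

end Summit.NavierStokesRegularity.NavierStokesRegularity.Cruxes.ScarEnvelopeTypeI.ZoomDictionary
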